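import Literature.NumberTheory.EllipticCurves.ModularSymbolsProofs
import Literature.NumberTheory.EllipticCurves.PeriodLatticeGamma1QuotientProofs
import HarnessLib

/-!
# The period lattice of `f ∈ S₂(Γ₀(N))` is already generated by the periods over `Γ₀(mN)`, `m ∣ N`

[Proofs] Theorems only (no definition, no named fact).  Topic `Literature/NumberTheory/EllipticCurves`;
namespace `Literature.NumberTheory.EllipticCurves.ModularForms` (cell `bsd-f2-manin`, planner `-an` g37,
MEMO-an §80; proposed tree path `Literature/NumberTheory/EllipticCurves/PeriodLatticeLevelRaisingProofs.lean`
or `Summits/BirchSwinnertonDyer/BirchSwinnertonDyer/Theorems/ManinLocalTwoThreePeriodLatticeLevelRaising.lean`,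
`--supports stmt-BirchSwinnertonDyer-22968 --as helper`).

Let `f ∈ S₂(Γ₀(N))`, `N ≥ 1`, and let `Λ_f = periodLattice f` be the subgroup of `ℂ` generated by the periods
`{∞, γ∞}_f`, `γ ∈ Γ₀(N)` (Manin 1972, Prop. 1.4 / Thm. 1.6: `γ ↦ {∞, γ∞}_f` is a homomorphism; tree
`cuspSymbol_mul_holds`).  For a level `mN` with `m ∣ N` the subgroup `Γ₀(mN) ≤ Γ₀(N)` has index `m`, with coset
representatives the lower unipotents `u_t = (1 0; Nt 1)`, `0 ≤ t < m`, and every `u_t` is PARABOLIC (it fixes the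
cusp `0`), so its period vanishes: `{∞, u_t ∞}_f = {∞, 1/(Nt)}_f = 0` — in the tree this is the Manin relation
`{∞, γ r}_f = {∞, γ∞}_f + {∞, r}_f` (`modularSymbol_gamma0_smul_holds`) at `r = 0`, `γ = u_t` (`u_t · 0 = 0`).
Hence (proved here, sorry-free):

* `cuspSymbol_eq_zero_of_apply_zero_one_eq_zero` — `{∞, γ∞}_f = 0` for every `γ ∈ Γ₀(N)` with upper-right
  entry `b = 0` (then `γ = ±(1 0; c 1)` is parabolic at `0`);
* `cuspSymbol_mem_closure_cuspSymbol_image_level_mul` — for `m ∣ N`, every period `{∞, γ∞}_f`, `γ ∈ Γ₀(N)`,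
  lies in the subgroup generated by the periods of the elements of `Γ₀(N)` that lie in `Γ₀(mN)`
  (`γ = δ·u_t` with `δ ∈ Γ₀(mN)`, `t ≡ (c/N)·d⁻¹ (mod m)`, `d = d_γ` a unit mod `N`);
* **`closure_cuspSymbol_image_level_mul_eq_periodLattice`** — so that subgroup IS `Λ_f`:
  `Λ_f(Γ₀(mN)) = Λ_f(Γ₀(N))` for `m ∣ N`.  Geometrically: the degeneracy map `X₀(mN) → X₀(N)` (identity on `ℍ`)
  is totally ramified at the cusp `0` when `m ∣ N`, so it factors through no unramified cover and is surjective on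
  `H₁`; the image of `H₁(X₀(mN), ℤ)` under `∫ 2πi f` is all of `Λ_f`;
* `le_closure_smul_cuspSymbol_image_level_mul` — the form consumed by the Kummer-monodromy line of MEMO-an §80:
  if `L ⊆ c·Λ_f` (the lattice clause of an optimal parametrisation, `Λ_E = c·Λ_f`), then `L` is contained in the
  subgroup generated by the scaled periods `c·{∞, δ∞}_f`, `δ ∈ Γ₀(N) ∩ Γ₀(mN)`.

Application (MEMO-an §80, the `σ`-monodromy proof of P79 `KummerCubeSeriesNotCubeAtThreeN`): a meromorphic cube
root on `ℍ` of the tangent-line function `ℓ_T ∘ φ` of a rational `3`-torsion point `T` transforms under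
`γ ∈ Γ₀(M)` by the Weil-pairing character `e₃(T, c·{∞, γ∞}_f / 3)`; invariance under `Γ₀(3N)` (`9 ∣ N`, so
`m = 3 ∣ N`) therefore forces `e₃(T, λ/3) = 1` for all `λ ∈ Λ_E`, i.e. `T = O`.  PARTITION unchanged ·
beyond-print theorem: no (Manin 1972 Thm. 1.9 + the ramification of `X₀(mN) → X₀(N)` at `0`; recorded as a
kernel theorem in the shape the cell needs) · BSD is not proved by this.

References: [Manin1972] Ju. I. Manin, *Parabolic points and zeta functions of modular curves*, Izv. AN SSSR 36
(1972), Prop. 1.4, Thm. 1.6, Thm. 1.9; [CremonaAlgorithms1997] J. E. Cremona, *Algorithms for modular elliptic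
curves*, 2nd ed. (1997), §2.1–2.2 (Manin symbols, the relation `{∞, γ r} = {∞, γ∞} + {∞, r}`);
[DiamondShurman2005] F. Diamond, J. Shurman, GTM 228, §1.2, §3.1 (indices and cusps of `Γ₀`).
-/

noncomputable section

open scoped MatrixGroups ModularForm

open CongruenceSubgroup

namespace Literature.NumberTheory.EllipticCurves.ModularForms

variable {N : ℕ} [NeZero N] (f : CuspForm (Gamma0 N) 2)

/-! ### Parabolic elements at the cusp `0` have zero period -/

/-- **`{∞, γ∞}_f = 0` if the upper-right entry of `γ ∈ Γ₀(N)` vanishes.**  Then `a d = 1`, `γ·0 = b/d = 0`,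
and the Manin relation `{∞, γ·0}_f = {∞, γ∞}_f + {∞, 0}_f` (`modularSymbol_gamma0_smul_holds`) reads
`{∞, 0} = {∞, γ∞} + {∞, 0}`.  (`γ = ±(1 0; c 1)` is parabolic, fixing the cusp `0`; Manin 1972, Thm. 1.9: parabolic
elements lie in the kernel of `γ ↦ {∞, γ∞}`.) [cite: Manin1972, Prop. 1.4 / Thm. 1.6 / Thm. 1.9] -/
theorem cuspSymbol_eq_zero_of_apply_zero_one_eq_zero (γ : Gamma0 N) (hb : ((γ : SL(2, ℤ)) 0 1 : ℤ) = 0) :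
    cuspSymbol f γ = 0 := by
  have hdet : ((γ : SL(2, ℤ)) 0 0 : ℤ) * (γ : SL(2, ℤ)) 1 1 = 1 := by
    have h := Matrix.SpecialLinearGroup.det_coe (γ : SL(2, ℤ))
    rw [Matrix.det_fin_two, hb] at h
    linarith
  have hd : ((γ : SL(2, ℤ)) 1 1 : ℤ) ≠ 0 := fun h0 ↦ by
    rw [h0, mul_zero] at hdet
    exact zero_ne_one hdet
  have hr : (((γ : SL(2, ℤ)) 1 0 : ℤ) : ℚ) * 0 + (((γ : SL(2, ℤ)) 1 1 : ℤ) : ℚ) ≠ 0 := by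
    rw [mul_zero, zero_add]
    exact_mod_cast hd
  have key := modularSymbol_gamma0_smul_holds f γ 0 hr
  have hq : ((((γ : SL(2, ℤ)) 0 0 : ℤ) : ℚ) * 0 + (((γ : SL(2, ℤ)) 0 1 : ℤ) : ℚ)) /
      ((((γ : SL(2, ℤ)) 1 0 : ℤ) : ℚ) * 0 + (((γ : SL(2, ℤ)) 1 1 : ℤ) : ℚ)) = 0 := by
    rw [hb]
    push_cast
    ring
  rw [hq] at key
  -- `{∞,0} = {∞,γ∞} + {∞,0}`
  have : cuspSymbol f γ + modularSymbol f 0 = 0 + modularSymbol f 0 := by rw [zero_add]; exact key.symm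
  exact add_right_cancel this

/-! ### The lower unipotents `(1 0; Nt 1) ∈ Γ₀(N)` -/

omit [NeZero N] in
/-- For every `t : ℤ` the matrix `(1 0; Nt 1)` is an element of `Γ₀(N)` with the displayed entries. [folklore] -/
private theorem exists_gamma0_lower_unipotent (t : ℤ) :
    ∃ u : Gamma0 N, ((u : SL(2, ℤ)) 0 0 : ℤ) = 1 ∧ ((u : SL(2, ℤ)) 0 1 : ℤ) = 0 ∧
      ((u : SL(2, ℤ)) 1 0 : ℤ) = N * t ∧ ((u : SL(2, ℤ)) 1 1 : ℤ) = 1 := by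
  let M : SL(2, ℤ) := ⟨!![1, 0; (N : ℤ) * t, 1], by rw [Matrix.det_fin_two_of]; ring⟩
  have hM : M ∈ Gamma0 N := by
    rw [Gamma0_mem]
    show ((!![1, 0; (N : ℤ) * t, 1] 1 0 : ℤ) : ZMod N) = 0
    simp
  exact ⟨⟨M, hM⟩, rfl, rfl, rfl, rfl⟩

/-- The period of a lower unipotent `(1 0; Nt 1)` vanishes. [cite: Manin1972, Thm. 1.9] -/
theorem cuspSymbol_lower_unipotent_eq_zero (u : Gamma0 N) (h01 : ((u : SL(2, ℤ)) 0 1 : ℤ) = 0) :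
    cuspSymbol f u = 0 :=
  cuspSymbol_eq_zero_of_apply_zero_one_eq_zero f u h01

/-! ### Coset decomposition `Γ₀(N) = ⋃_t Γ₀(mN)·(1 0; Nt 1)` for `m ∣ N` -/

/-- **Coset arithmetic.**  For `m ∣ N` and `γ = (a b; c d) ∈ Γ₀(N)` there is `t : ℤ` with `mN ∣ c − dNt`:
`d` is a unit modulo `N` (`isUnit_apply_one_one`), hence modulo `m`, and `t ≡ (c/N)·d⁻¹ (mod m)`. [folklore] -/
private theorem exists_level_mul_dvd_sub {m : ℕ} (hm : m ∣ N) (γ : Gamma0 N) :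
    ∃ t : ℤ, ((m * N : ℕ) : ℤ) ∣ ((γ : SL(2, ℤ)) 1 0 : ℤ) - ((γ : SL(2, ℤ)) 1 1 : ℤ) * (N * t) := by
  haveI : NeZero m := ⟨fun h0 ↦ by
    rw [h0, zero_dvd_iff] at hm
    exact NeZero.ne N hm⟩
  set c : ℤ := ((γ : SL(2, ℤ)) 1 0 : ℤ) with hc_def
  set d : ℤ := ((γ : SL(2, ℤ)) 1 1 : ℤ) with hd_def
  obtain ⟨c', hc'⟩ : (N : ℤ) ∣ c := dvd_entry_of_mem_Gamma0 N γ.2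
  -- `d` is a unit modulo `m`
  have hdN : IsUnit ((d : ℤ) : ZMod N) := isUnit_apply_one_one γ
  have hdm : IsUnit ((d : ℤ) : ZMod m) := by
    have h := hdN.map (ZMod.castHom hm (ZMod m))
    rwa [map_intCast] at h
  obtain ⟨w, hw⟩ := hdm
  -- `t ≡ c' · d⁻¹ (mod m)`
  set t₀ : ZMod m := (c' : ZMod m) * ((w⁻¹ : (ZMod m)ˣ) : ZMod m) with ht₀
  refine ⟨(t₀.val : ℤ), ?_⟩
  have hmod : (((c' - d * (t₀.val : ℤ) : ℤ)) : ZMod m) = 0 := by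
    push_cast
    rw [ZMod.natCast_zmod_val, ht₀, ← hw, ← mul_assoc, mul_comm (w : ZMod m) (c' : ZMod m), mul_assoc,
      Units.mul_inv, mul_one, sub_self]
  obtain ⟨e, he⟩ := (ZMod.intCast_zmod_eq_zero_iff_dvd _ m).mp hmod
  refine ⟨e, ?_⟩
  rw [hc']
  push_cast
  linear_combination (N : ℤ) * he

/-- **Every period of `Γ₀(N)` is generated by periods of `Γ₀(mN)`, `m ∣ N`.**  Write `γ = δ · u_t` with
`u_t = (1 0; Nt 1)` and `δ = γ u_t⁻¹ ∈ Γ₀(mN)` (`exists_level_mul_dvd_sub`); then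
`{∞, γ∞} = {∞, δ∞} + {∞, u_t∞} = {∞, δ∞}` (`cuspSymbol_mul_holds`, `cuspSymbol_lower_unipotent_eq_zero`).
[cite: Manin1972, Prop. 1.4 / Thm. 1.6 / Thm. 1.9] -/
theorem cuspSymbol_mem_closure_cuspSymbol_image_level_mul {m : ℕ} (hm : m ∣ N) (γ : Gamma0 N) :
    cuspSymbol f γ ∈ AddSubgroup.closure
      (cuspSymbol f '' {δ : Gamma0 N | (δ : SL(2, ℤ)) ∈ Gamma0 (m * N)}) := by
  obtain ⟨t, ht⟩ := exists_level_mul_dvd_sub hm γ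
  obtain ⟨u, h00, h01, h10, h11⟩ := exists_gamma0_lower_unipotent (N := N) t
  set δ : Gamma0 N := γ * u⁻¹ with hδ
  have hγ : γ = δ * u := by rw [hδ, inv_mul_cancel_right]
  -- the lower-left entry of `δ = γ u⁻¹` is `c - d N t` (`u⁻¹ = adj u = (1 0; -Nt 1)`)
  have hδ10 : ((δ : SL(2, ℤ)) 1 0 : ℤ) =
      ((γ : SL(2, ℤ)) 1 0 : ℤ) - ((γ : SL(2, ℤ)) 1 1 : ℤ) * (N * t) := by
    rw [hδ, Subgroup.coe_mul, Matrix.SpecialLinearGroup.coe_mul]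
    simp [Matrix.mul_apply, Fin.sum_univ_two, Matrix.adjugate_fin_two, h10, h11]
    ring
  have hδmem : (δ : SL(2, ℤ)) ∈ Gamma0 (m * N) := by
    rw [Gamma0_mem]
    have : ((((δ : SL(2, ℤ)) 1 0 : ℤ)) : ZMod (m * N)) = 0 := by
      rw [hδ10]
      exact (ZMod.intCast_zmod_eq_zero_iff_dvd _ (m * N)).mpr ht
    exact_mod_cast this
  have hsplit : cuspSymbol f γ = cuspSymbol f δ := by
    rw [hγ, cuspSymbol_mul_holds f δ u, cuspSymbol_lower_unipotent_eq_zero f u h01, add_zero]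
  rw [hsplit]
  exact AddSubgroup.subset_closure ⟨δ, hδmem, rfl⟩

/-- **`Λ_f(Γ₀(mN)) = Λ_f(Γ₀(N))` for `m ∣ N`**: the subgroup of `ℂ` generated by the periods `{∞, δ∞}_f` of the
elements of `Γ₀(N)` lying in `Γ₀(mN)` is the whole period lattice `Λ_f` (the degeneracy map `X₀(mN) → X₀(N)` is
totally ramified at the cusp `0`, hence surjective on `H₁`).  [cite: Manin1972, Thm. 1.9] -/
theorem closure_cuspSymbol_image_level_mul_eq_periodLattice {m : ℕ} (hm : m ∣ N) :
    AddSubgroup.closure (cuspSymbol f '' {δ : Gamma0 N | (δ : SL(2, ℤ)) ∈ Gamma0 (m * N)}) =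
      periodLattice f := by
  apply le_antisymm
  · rw [AddSubgroup.closure_le]
    rintro _ ⟨δ, -, rfl⟩
    exact cuspSymbol_mem_periodLattice f δ
  · rw [periodLattice, AddSubgroup.closure_le]
    rintro _ ⟨γ, rfl⟩
    exact cuspSymbol_mem_closure_cuspSymbol_image_level_mul f hm γ

/-- **Scaled form (the lattice clause).**  If every element of `L` is `c·w` with `w ∈ Λ_f` (for an optimal
parametrisation with Manin constant `c`: `Λ_E ⊆ c·Λ_f`), then `L` lies in the subgroup generated by the scaled
periods `c·{∞, δ∞}_f`, `δ ∈ Γ₀(N) ∩ Γ₀(mN)`, `m ∣ N`. [cite: Manin1972, Thm. 1.9] -/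
theorem le_closure_smul_cuspSymbol_image_level_mul {m : ℕ} (hm : m ∣ N) (c : ℂ) (L : AddSubgroup ℂ)
    (hL : ∀ z ∈ L, ∃ w ∈ periodLattice f, z = c * w) :
    L ≤ AddSubgroup.closure
      ((fun δ : Gamma0 N ↦ c * cuspSymbol f δ) '' {δ : Gamma0 N | (δ : SL(2, ℤ)) ∈ Gamma0 (m * N)}) := by
  intro z hz
  obtain ⟨w, hw, rfl⟩ := hL z hz
  rw [← closure_cuspSymbol_image_level_mul_eq_periodLattice f hm] at hw
  have himage : (fun δ : Gamma0 N ↦ c * cuspSymbol f δ) '' {δ : Gamma0 N | (δ : SL(2, ℤ)) ∈ Gamma0 (m * N)} =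
      (AddMonoidHom.mulLeft c) '' (cuspSymbol f '' {δ : Gamma0 N | (δ : SL(2, ℤ)) ∈ Gamma0 (m * N)}) := by
    rw [Set.image_image]
    rfl
  rw [himage, ← AddMonoidHom.map_closure]
  exact ⟨w, hw, rfl⟩

end Literature.NumberTheory.EllipticCurves.ModularForms

end
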